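import Mathlib
import Summits.ValiantsHypothesis.ValiantsHypothesis.Theses.NewtonUnitEquations
import Summits.ValiantsHypothesis.ValiantsHypothesis.Theorems.NewtonTauWeak.Negative.LoadBearing

/-!
# Line `regrouping-square-budget` for crux `NewtonUnitEquations.NewtonTauRoot` (stmt-ValiantsHypothesis-18547)

Lead-owned skeleton (prover-line-stmt-ValiantsHypothesis-18547-0, 2026-08-17), built from the crux idea card
`Cruxes/NewtonTauRoot/Ideas/regrouping-square-budget.md` (the ideator's `Sketch.lean` evidence file is not mounted
in the lead's jail; statements re-derived from the card, constants re-computed here).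

THE LINE.  `NewtonTauRoot` (`vert(Σ_{i<k}Π_{j<m} f_ij) ≤ 2^{a m}(k t+2)^{b(⌊√m⌋+1)}` for `t`-sparse `f_ij`) is the
image under BLOCK REGROUPING (blocks of `s = ⌊√m⌋` consecutive factors, `q = m/s + 1` blocks, block sparsity
`T = t^s`) of the `T`-TIGHT "square budget"
  `SquareBudget a c d : vert(Σ_{i<k}Π_{j<q} f_ij) ≤ 2^{a q²}(k+2)^{c q}(T+2)^d` for `T`-sparse `f_ij`,
(`stub_regroupTransfer`, M: `q² ≤ 16 m`, `(k+2)^{c q} ≤ (k t+2)^{2c(s+1)}`, `(t^s+2)^d ≤ (k t+2)^{d(s+1)}`), and the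
square budget is what a LOSSY PEELING induction on the number of factors produces
(`stub_lossyPeelInduction`, M: `B(0) = k`, `B(ℓ+1) = 2^{a(ℓ+1)}(k+2)^c·B(ℓ) + (k T+2)^e` gives
`B(q) ≤ 2^{(a+1) q²}(k+2)^{(c+e+1) q}(T+2)^e`) from the ONE-STEP statement
  `LossyPeeling a c e`: for `k` products `G_i = Π_{j<ℓ} g_ij` of `T`-sparse factors and `T`-sparse multipliers `p_i`,
  `vert(Σ_i p_i G_i) ≤ 2^{a(ℓ+1)}(k+2)^c · V + (k T+2)^e` whenever `V` bounds `vert(Σ_i d_i X^{u_i} G_i)` for every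
  aligned combination (one shift `u_i`, one scalar `d_i` per product)
(`stub_lossyPeeling`, OPEN, HARDEST: the sibling line `Cruxes/NewtonTauWeak/Lines/aligned_peeling.lean` asks the same
with an ABSOLUTE multiplier `C`; here the multiplier may grow like `2^{O(ℓ)}·poly(k)` — uniformity is demanded in the
sparsity `T` only, which is the uniformity the aligned-peeling kit probes j019159/j019319 measured).

Composition `NewtonTauRoot_of` is kernel-checked (no `sorry` outside `stub_*`): constants
`(a, b) = (16(a₀+1), 2(c₀+e₀+1)+e₀)`.

Disproof / negatives used: `Theorems/NewtonTauRoot/Negative/LoadBearing.lean` (refuter one-shot on this crux):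
`newtonTauRoot_false_without_sparsity` honoured (`T` enters `(k T+2)^e` and `(T+2)^d`), `not_newtonTauRootBoundNoK/NoT`
honoured (`(k+2)^{c q}`, `(T+2)^d` kept), corners `k = 0`, `m = 0` harmless; sibling `not_newtonTauBoundNoM`
(q-dependence kept: `2^{a q²}`).  No registered stub is an instance of a landed `Negative/*` lemma.
-/

set_option linter.dupNamespace false

namespace Summit.ValiantsHypothesis.ValiantsHypothesis.Cruxes.NewtonTauRoot.RegroupingSquareBudget

open scoped BigOperators
open MvPolynomial
open Summit.ValiantsHypothesis.ValiantsHypothesis.Theses.NewtonUnitEquations (NewtonTauRoot NewtonTauWeak)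
open Summit.ValiantsHypothesis.ValiantsHypothesis.Theorems.NewtonTauWeak.Negative
  (vert vert_le_card_support vert_sum_fin_zero vert_sum_fin_zero')

noncomputable section

/-! ### Statements -/

/-- ROOT BOUND with fixed constants `(a, b)`: `NewtonTauRoot` is `∃ a b, RootBound a b` (by `Iff.rfl`). -/
def RootBound (a b : ℕ) : Prop :=
  ∀ (k m t : ℕ) (f : Fin k → Fin m → MvPolynomial (Fin 2) ℂ), (∀ i j, (f i j).support.card ≤ t) →
    vert (∑ i, ∏ j, f i j) ≤ 2 ^ (a * m) * (k * t + 2) ^ (b * (Nat.sqrt m + 1))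

/-- SQUARE BUDGET with constants `(a, c, d)` — the card's `T`-tight transfer target `C⁺`:
`vert(Σ_{i<k} Π_{j<q} f_ij) ≤ 2^{a q²}(k+2)^{c q}(T+2)^d` for `T`-sparse `f_ij`; the sparsity exponent `d` is ABSOLUTE. -/
def SquareBudget (a c d : ℕ) : Prop :=
  ∀ (k q T : ℕ) (f : Fin k → Fin q → MvPolynomial (Fin 2) ℂ), (∀ i j, (f i j).support.card ≤ T) →
    vert (∑ i, ∏ j, f i j) ≤ 2 ^ (a * q ^ 2) * (k + 2) ^ (c * q) * (T + 2) ^ d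

/-- LOSSY ALIGNED PEELING with constants `(a, c, e)`: one `T`-sparse multiplication step costs a factor
`2^{a(ℓ+1)}(k+2)^c` on the best ALIGNED vertex count `V` plus `(k T+2)^e` fresh vertices (`ℓ` = current number of
factors).  The sibling crux's `AlignedPeeling C c` is the case of an absolute multiplier. -/
def LossyPeeling (a c e : ℕ) : Prop :=
  ∀ (k ℓ T V : ℕ) (g : Fin k → Fin ℓ → MvPolynomial (Fin 2) ℂ) (p : Fin k → MvPolynomial (Fin 2) ℂ),
    (∀ i j, (g i j).support.card ≤ T) → (∀ i, (p i).support.card ≤ T) →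
    (∀ (u : Fin k → (Fin 2 →₀ ℕ)) (d : Fin k → ℂ), vert (∑ i, monomial (u i) (d i) * ∏ j, g i j) ≤ V) →
      vert (∑ i, p i * ∏ j, g i j) ≤ 2 ^ (a * (ℓ + 1)) * (k + 2) ^ c * V + (k * T + 2) ^ e

/-! ### Registered stubs (statements inlined over `vert` + Mathlib only; `sorry` lives only here) -/

/-- STUB 1 (M, provable now) — **block regrouping transfer**: a square budget with constants `(a, c, d)` gives the
root bound with constants `(16 a, 2 c + d)`.  Proof: `m = 0` (`vert ≤ 1`), `k = 0` (`vert = 0`) and `t = 0 < m`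
(the sum is `0`) are corners; otherwise put `s := Nat.sqrt m ≥ 1`, `q := m / s + 1` (`m < q s`, `q ≤ s + 3`,
`q² ≤ 16 m`), pad every product with `q s - m` unit factors (`Fin.append f 1`, still `t`-sparse as `t ≥ 1`), regroup
`Fin (q * s) ≃ Fin q × Fin s` (`finProdFinEquiv`, `Fintype.prod_equiv`, `Fintype.prod_prod_type`) into `q` block
products of sparsity `≤ t^s` (`Literature…KPTT.card_support_prod_univ_le_pow`), apply `h` at `(k, q, t^s)`, and
finish with `2^{a q²} ≤ 2^{16 a m}`, `(k+2)^{c q} ≤ (k t+2)^{2 c (s+1)}` (`k+2 ≤ k t+2`, `q ≤ 2(s+1)`),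
`(t^s+2)^d ≤ (k t+2)^{d (s+1)}` (`t^s + 2 ≤ (t+2)^s ≤ (k t+2)^s`, `k ≥ 1`). -/
theorem stub_regroupTransfer (a c d : ℕ)
    (h : ∀ (k q T : ℕ) (f : Fin k → Fin q → MvPolynomial (Fin 2) ℂ), (∀ i j, (f i j).support.card ≤ T) →
      vert (∑ i, ∏ j, f i j) ≤ 2 ^ (a * q ^ 2) * (k + 2) ^ (c * q) * (T + 2) ^ d)
    (k m t : ℕ) (f : Fin k → Fin m → MvPolynomial (Fin 2) ℂ) (hf : ∀ i j, (f i j).support.card ≤ t) :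
    vert (∑ i, ∏ j, f i j) ≤ 2 ^ (16 * a * m) * (k * t + 2) ^ ((2 * c + d) * (Nat.sqrt m + 1)) := by
  sorry

/-- STUB 2 (M, provable now) — **lossy peel induction**: lossy aligned peeling with constants `(a, c, e)` gives the
square budget with constants `(a + 1, c + e + 1, e)`.  Proof (adapt `Cruxes/NewtonTauWeak/Lines/aligned_peeling_peelInduction.lean`,
whose multiplier is constant): by induction on `ℓ` prove the ALIGNED claim
`∀ k T g u d, (T-sparse g) → vert(Σ_i monomial (u i) (d i) * Π_{j<ℓ} g i j) ≤ B ℓ` with `B 0 = k`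
(`vert ≤ #supp ≤ k`) and `B (ℓ+1) = 2^{a(ℓ+1)}(k+2)^c · B ℓ + (k T+2)^e` (split off the last factor with
`Fin.prod_univ_castSucc`, absorb the monomial into it: `p i := monomial (u i) (d i) * g i (Fin.last ℓ)` is `T`-sparse,
apply `h` with `V := B ℓ`); then `B q ≤ 2^{a q²}(k+2)^{c q}(k + q (k T+2)^e)` and, for `q ≥ 1`, `T ≥ 1`,
`k + q (k T+2)^e ≤ (q+1)(k+2)^{e+1}(T+2)^e ≤ 2^{q²}(k+2)^{(e+1) q}(T+2)^e` (`k T+2 ≤ (k+2)(T+2)`); corners `q = 0`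
(`vert ≤ 1`) and `T = 0 < q` (sum `= 0`); finally `u i = 0`, `d i = 1`. -/
theorem stub_lossyPeelInduction (a c e : ℕ)
    (h : ∀ (k ℓ T V : ℕ) (g : Fin k → Fin ℓ → MvPolynomial (Fin 2) ℂ) (p : Fin k → MvPolynomial (Fin 2) ℂ),
      (∀ i j, (g i j).support.card ≤ T) → (∀ i, (p i).support.card ≤ T) →
      (∀ (u : Fin k → (Fin 2 →₀ ℕ)) (d : Fin k → ℂ), vert (∑ i, monomial (u i) (d i) * ∏ j, g i j) ≤ V) →
        vert (∑ i, p i * ∏ j, g i j) ≤ 2 ^ (a * (ℓ + 1)) * (k + 2) ^ c * V + (k * T + 2) ^ e)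
    (k q T : ℕ) (f : Fin k → Fin q → MvPolynomial (Fin 2) ℂ) (hf : ∀ i j, (f i j).support.card ≤ T) :
    vert (∑ i, ∏ j, f i j) ≤ 2 ^ ((a + 1) * q ^ 2) * (k + 2) ^ ((c + e + 1) * q) * (T + 2) ^ e := by
  sorry

/-- STUB 3 (XL, OPEN, HARDEST) — **lossy aligned peeling**: some constants `(a, c, e)` make the one-step statement
hold.  Content: uniformity in the sparsity `T` of one sparse multiplication step on `k` products, the multiplier being
free to grow like `2^{O(ℓ)}·poly(k)`.  `k = 1` is Ostrowski (`Newt(p G) = Newt p + Newt G`: `vert ≤ V + T`); at level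
`ℓ` the statement is vacuous for `e ≥ ℓ + 1` (`vert ≤ #supp ≤ k T^{ℓ+1}`), so its content is at levels `ℓ ≥ e`.
Why it might fail: a pair of PRODUCTS of sparse polynomials whose coefficient-ratio function is constant on each of
`r → ∞` thick convexly curved boundary bands (the band construction of `Lines/aligned-peeling.md` §4 does this with
GENERAL polynomials, ratio `LHS/V ≈ r`), with the exposed chains of length `> T^e / r` — no such product pair is known
(ratio level sets of products are unit-equation sets: boxes/characters on digit frames, lattice lines under torus
rescaling). -/
theorem stub_lossyPeeling :
    ∃ a c e : ℕ, ∀ (k ℓ T V : ℕ) (g : Fin k → Fin ℓ → MvPolynomial (Fin 2) ℂ) (p : Fin k → MvPolynomial (Fin 2) ℂ),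
      (∀ i j, (g i j).support.card ≤ T) → (∀ i, (p i).support.card ≤ T) →
      (∀ (u : Fin k → (Fin 2 →₀ ℕ)) (d : Fin k → ℂ), vert (∑ i, monomial (u i) (d i) * ∏ j, g i j) ≤ V) →
        vert (∑ i, p i * ∏ j, g i j) ≤ 2 ^ (a * (ℓ + 1)) * (k + 2) ^ c * V + (k * T + 2) ^ e := by
  sorry

/-! ### Consistency: each named statement IS its registered stub (definitionally) -/

theorem regroupTransfer_holds : ∀ a c d : ℕ, SquareBudget a c d → RootBound (16 * a) (2 * c + d) :=
  stub_regroupTransfer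
theorem lossyPeelInduction_holds : ∀ a c e : ℕ, LossyPeeling a c e → SquareBudget (a + 1) (c + e + 1) e :=
  stub_lossyPeelInduction
theorem lossyPeeling_holds : ∃ a c e : ℕ, LossyPeeling a c e := stub_lossyPeeling

/-- The crux by name is `∃ a b, RootBound a b` (`vert` is the crux's literal subterm). -/
theorem newtonTauRoot_iff : NewtonTauRoot ↔ ∃ a b : ℕ, RootBound a b := Iff.rfl

/-! ### Name-keyed aliases of the stub statements (hypotheses of the composition) -/
namespace Registered

/-- Alias of the statement of STUB 1, keyed by the registered stub name. -/
abbrev stub_regroupTransfer : Prop := ∀ a c d : ℕ, SquareBudget a c d → RootBound (16 * a) (2 * c + d)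

/-- Alias of the statement of STUB 2, keyed by the registered stub name. -/
abbrev stub_lossyPeelInduction : Prop := ∀ a c e : ℕ, LossyPeeling a c e → SquareBudget (a + 1) (c + e + 1) e

/-- Alias of the statement of STUB 3, keyed by the registered stub name. -/
abbrev stub_lossyPeeling : Prop := ∃ a c e : ℕ, LossyPeeling a c e

end Registered

/-! ### Composition (PROVED): the stubs give the crux BY NAME -/

/-- **The registered stubs compose to the crux `NewtonUnitEquations.NewtonTauRoot`** (literally the route decl):
lossy peeling `(a, c, e)` ⟹ square budget `(a+1, c+e+1, e)` ⟹ root bound `(16(a+1), 2(c+e+1)+e)`. -/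
theorem NewtonTauRoot_of (h₁ : Registered.stub_lossyPeeling) (h₂ : Registered.stub_lossyPeelInduction)
    (h₃ : Registered.stub_regroupTransfer) : NewtonTauRoot := by
  obtain ⟨a, c, e, h⟩ := h₁
  exact ⟨16 * (a + 1), 2 * (c + e + 1) + e, h₃ (a + 1) (c + e + 1) e (h₂ a c e h)⟩

/-- The crux from the stubs as they stand (`sorry` only inside `stub_*`). -/
theorem NewtonTauRoot_of_stubs : NewtonTauRoot :=
  NewtonTauRoot_of stub_lossyPeeling stub_lossyPeelInduction stub_regroupTransfer

/-- The transfer alone: the square budget (any constants) implies the crux (stated as `∃ a b, RootBound a b`, which is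
`NewtonTauRoot` by `newtonTauRoot_iff`), modulo the M-stub `stub_regroupTransfer`. -/
theorem rootBound_of_squareBudget (h : ∃ a c d : ℕ, SquareBudget a c d) : ∃ a b : ℕ, RootBound a b := by
  obtain ⟨a, c, d, h⟩ := h
  exact ⟨16 * a, 2 * c + d, stub_regroupTransfer a c d h⟩

/-! ### Calibration (PROVED): where the statements sit -/

/-- The sharp form gives the square budget's `k`-side sibling trivially: `NewtonTauWeak (a, b)` ⟹
`vert ≤ 2^{a q}(k T+2)^b ≤ 2^{a q²}·((k+2)(T+2))^b`, i.e. `SquareBudget a b b` up to `(k+2)^b ≤ (k+2)^{b q}` for `q ≥ 1`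
(and `q = 0`: `vert ≤ 1`).  So `NewtonTauWeak → SquareBudget a b b`. -/
theorem squareBudget_of_newtonTauWeak (hW : NewtonTauWeak) : ∃ a c d : ℕ, SquareBudget a c d := by
  obtain ⟨a, b, hW⟩ := hW
  refine ⟨a, b, b, fun k q T f hf => ?_⟩
  rcases Nat.eq_zero_or_pos q with rfl | hq
  · calc vert (∑ i, ∏ j, f i j) ≤ 1 := vert_sum_fin_zero' k f
      _ ≤ 2 ^ (a * 0 ^ 2) * (k + 2) ^ (b * 0) * (T + 2) ^ b := by
          have : 1 ≤ (T + 2) ^ b := Nat.one_le_pow _ _ (by omega)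
          simpa using this
  calc vert (∑ i, ∏ j, f i j) ≤ 2 ^ (a * q) * (k * T + 2) ^ b := hW k q T f hf
    _ ≤ 2 ^ (a * q ^ 2) * ((k + 2) ^ q * (T + 2)) ^ b := by
        apply Nat.mul_le_mul
        · exact Nat.pow_le_pow_right (by omega) (Nat.mul_le_mul_left _ (by nlinarith))
        · apply Nat.pow_le_pow_left
          have hk : k + 2 ≤ (k + 2) ^ q := by
            calc k + 2 = (k + 2) ^ 1 := (pow_one _).symm
              _ ≤ (k + 2) ^ q := Nat.pow_le_pow_right (by omega) hq
          nlinarith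
    _ = 2 ^ (a * q ^ 2) * (k + 2) ^ (b * q) * (T + 2) ^ b := by
        rw [mul_pow, ← pow_mul, mul_comm q b]; ring

end

end Summit.ValiantsHypothesis.ValiantsHypothesis.Cruxes.NewtonTauRoot.RegroupingSquareBudget
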